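import Literature.NumberTheory.EllipticCurves.KodairaNeronUnramifiedAdditiveBoundProofs
import HarnessLib

/-!
# Kodaira–Néron over `K_v^nr`, additive reduction: `p ∤ [E(K_v^nr) : E₀(K_v^nr)]` whenever
# `p ∤ #Φ(k̄)` read off the Kodaira symbol (Silverman *AEC* Thm. VII.6.1 / *ATAEC* Cor. IV.9.2(d), Table 4.1)

`Proofs` file (theorems only, no definitions, no named facts) in topic `NumberTheory/EllipticCurves`,
sibling of `KodairaNeronUnramifiedAdditiveBoundProofs` (which EXPORTS only `≤ 4` from the type-by-type
index computation over the henselian discrete valuation ring `𝒪ⁿʳ` of `K_v^nr`: values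
`1, 2, {1,3}, {1,2,4}, {2,4}, {1,3}, 2, 1` for II, III, IV, I₀*, Iₙ*, IV*, III*, II* — *ATAEC* Table 4.1:
`c̄ = 1, 2, 3, 4, 4, 3, 2, 1`) and of `KodairaNeronUnramifiedAdditiveThreeProofs` (the `3`-adic column).
This file exports the whole COPRIMALITY content of the table: for a prime `p` with
`p ∤ componentGroupOrder (Tate type)` (`KodairaSymbol.componentGroupOrder` = `c̄` of Table 4.1), `p` does
not divide the index — the proof of the `≤ 4` export verbatim, each case closed by `omega` against the
componentGroupOrder of that type.

* `not_dvd_index_nonsingularReductionSubgroup_map_of_isAdditive` — `p ∤ [J(K_v^nr) : E₀]`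
  (`J = X₀ ⊗ 𝒪ⁿʳ`) when Tate's algorithm returns an additive type `s` on `X₀` with
  `p ∤ s.componentGroupOrder`;
* `WeierstrassCurve.exists_nsmul_reducesToNonsingular_not_dvd_of_hasAdditiveReduction` — the
  `K̄_v`-form: for `X/K_v` minimal with ADDITIVE reduction and `p ∤ #Φ(k̄)` of its Tate type there is
  `0 < c ≤ 4`, `p ∤ c`, with `c • P ∈ E₀` for every `I_𝔐`-fixed `P ∈ X(K̄_v)` (the proof of
  `exists_nsmul_reducesToNonsingular_not_three_dvd_of_hasAdditiveReduction` verbatim).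

Consumer (cell `b2b-bsdres`, team n1011, row T-GP6): the additive case of Gross–Parson 2012 Lemma 6
(`Φ[p] = 0` ⟹ the Kummer image of `E[p]` is the unramified cohomology): with `p ∤ c` and
`c • E[p^∞]^{I_v} ⊆ E₀`, `E[p^∞]^{I_v} = 0` at an additive `v ∤ p`.

## References

* J. H. Silverman, *The Arithmetic of Elliptic Curves*, 2nd ed., GTM 106 (2009): Thm. VII.6.1,
  Cor. VII.6.2 (PDF p. 177). [SilvermanAEC2009]
* J. H. Silverman, *Advanced Topics in the Arithmetic of Elliptic Curves*, GTM 151 (1994), §IV.9: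
  Cor. 9.2(d), Algorithm 9.4 and Table 4.1 (PDF pp. 340–350, 365). [SilvermanATAEC1994]
* B. H. Gross, J. A. Parson, *On the local divisibility of Heegner points* (2012), Lemma 6 (p. 226)
  ("`Φ[I₀] = 0`"; the hypothesis this file serves). [GrossParson2011]

## Design

No definitions; theorems only; conventions, binders and `maxHeartbeats` exactly as in
`KodairaNeronUnramifiedAdditiveThreeProofs` (the proofs are that file's proofs with the `p`-adic
conclusion carried through).
-/

noncomputable section

open scoped Classical NNReal
open NumberField IsDedekindDomain Field Polynomial IsLocalRing

universe u

namespace IsDedekindDomain.HeightOneSpectrum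

open Literature.NumberTheory.EllipticCurves Literature.NumberTheory.EllipticCurves.LocalIndex
  Literature.NumberTheory.GaloisRepresentations
  Literature.NumberTheory.GaloisRepresentations.IsNonarchimedeanLocalField
  Literature.NumberTheory.DiophantineGeometry Literature.NumberTheory.DiophantineGeometry.TateAlgorithm
  Literature.NumberTheory.DiophantineGeometry.KodairaSymbol

variable {K : Type u} [Field K] [NumberField K] {v : HeightOneSpectrum (𝓞 K)}
  {w : Valuation (AlgebraicClosure (v.adicCompletion K)) ℝ≥0}
  (hw : ∀ x, (w x : ℝ) = spectralNorm (v.adicCompletion K) (AlgebraicClosure (v.adicCompletion K)) x)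

/-! ## `p ∤ [J(K_v^nr) : E₀]` when `p ∤ #Φ(k̄)` of the (additive) Tate type -/

set_option maxHeartbeats 4000000 in
include hw in
/-- **`p ∤ [J(K_v^nr) : E₀]` when Tate's algorithm returns an additive type `s` on `X₀` with
`p ∤ s.componentGroupOrder`** (`J = X₀ ⊗ 𝒪ⁿʳ`, `X₀` an arbitrary Weierstrass equation over `𝓞_v`
with `Δ ≠ 0`, `p` a prime): Silverman, *ATAEC* Table 4.1 (`c̄ = 1, 2, 3, 4, 4, 3, 2, 1` for II, III, IV,
I₀*, Iₙ*, IV*, III*, II*; the index over `𝒪ⁿʳ` is `1, 2, ∈{1,3}, ∈{1,2,4}, ∈{2,4}, ∈{1,3}, 2, 1`) — the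
proof of `index_nonsingularReductionSubgroup_map_le_four_of_isAdditive` verbatim, with the coprimality
conclusion. [cite: SilvermanATAEC1994, Cor. IV.9.2(d) with IV.9.4 and Table 4.1 (PDF pp. 340–346, 365)]
[cite: SilvermanAEC2009, Thm. VII.6.1 (PDF p. 177)] -/
theorem not_dvd_index_nonsingularReductionSubgroup_map_of_isAdditive
    [IsDiscreteValuationRing (Valuation.valuationSubring (Valuation.comap (algebraMap (maxUnramified (v.adicCompletion K)) (AlgebraicClosure (v.adicCompletion K))) w))] [HenselianLocalRing (Valuation.valuationSubring (Valuation.comap (algebraMap (maxUnramified (v.adicCompletion K)) (AlgebraicClosure (v.adicCompletion K))) w))]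
    {φ : (v.adicCompletionIntegers K) →+* (Valuation.valuationSubring (Valuation.comap (algebraMap (maxUnramified (v.adicCompletion K)) (AlgebraicClosure (v.adicCompletion K))) w))} (hφ : ∀ a, (((φ a : (Valuation.valuationSubring (Valuation.comap (algebraMap (maxUnramified (v.adicCompletion K)) (AlgebraicClosure (v.adicCompletion K))) w))) : (maxUnramified (v.adicCompletion K))) : (AlgebraicClosure (v.adicCompletion K))) = algebraMap (v.adicCompletion K) (AlgebraicClosure (v.adicCompletion K)) (a : (v.adicCompletion K)))
    (X₀ : WeierstrassCurve (v.adicCompletionIntegers K)) (hΔ : X₀.Δ ≠ 0) (hs : X₀.kodairaSymbolOfMinimal.IsAdditive)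
    {p : ℕ} (hp : p.Prime) (hps : ¬ p ∣ X₀.kodairaSymbolOfMinimal.componentGroupOrder) :
    letI : DecidableEq (maxUnramified (v.adicCompletion K)) := fun a b ↦ Classical.propDecidable (a = b)
    ¬ p ∣ ((X₀.map φ).nonsingularReductionSubgroup (integers_valuationRing_valuation (Valuation.valuationSubring (Valuation.comap (algebraMap (maxUnramified (v.adicCompletion K)) (AlgebraicClosure (v.adicCompletion K))) w)) (maxUnramified (v.adicCompletion K)))).index := by
  letI instDec : DecidableEq (maxUnramified (v.adicCompletion K)) := fun a b ↦ Classical.propDecidable (a = b)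
  haveI : PerfectField (ResidueField (v.adicCompletionIntegers K)) := PerfectField.ofFinite
  have hvR := integers_valuationRing_valuation (Valuation.valuationSubring (Valuation.comap (algebraMap (maxUnramified (v.adicCompletion K)) (AlgebraicClosure (v.adicCompletion K))) w)) (maxUnramified (v.adicCompletion K))
  have hinjR := IsFractionRing.injective (Valuation.valuationSubring (Valuation.comap (algebraMap (maxUnramified (v.adicCompletion K)) (AlgebraicClosure (v.adicCompletion K))) w)) (maxUnramified (v.adicCompletion K))
  show ¬ p ∣ ((X₀.map φ).nonsingularReductionSubgroup hvR).index
  have hp1 : p ≠ 1 := hp.one_lt.ne'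
  have hp2 : ¬ p ∣ 1 := fun h ↦ hp1 (Nat.dvd_one.mp h)
  -- transfer of the `π`-adic conditions
  have T : ∀ (a : (v.adicCompletionIntegers K)) (k : ℕ), a ∈ maximalIdeal (v.adicCompletionIntegers K) ^ k → φ a ∈ maximalIdeal (Valuation.valuationSubring (Valuation.comap (algebraMap (maxUnramified (v.adicCompletion K)) (AlgebraicClosure (v.adicCompletion K))) w)) ^ k :=
    fun a k h ↦ (map_mem_maximalIdeal_pow_iff hw hφ a k).mpr h
  have T1 : ∀ a : (v.adicCompletionIntegers K), a ∈ maximalIdeal (v.adicCompletionIntegers K) → φ a ∈ maximalIdeal (Valuation.valuationSubring (Valuation.comap (algebraMap (maxUnramified (v.adicCompletion K)) (AlgebraicClosure (v.adicCompletion K))) w)) :=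
    fun a h ↦ (map_mem_maximalIdeal_iff hw hφ a).mpr h
  have N : ∀ (a : (v.adicCompletionIntegers K)) (k : ℕ), a ∉ maximalIdeal (v.adicCompletionIntegers K) ^ k → φ a ∉ maximalIdeal (Valuation.valuationSubring (Valuation.comap (algebraMap (maxUnramified (v.adicCompletion K)) (AlgebraicClosure (v.adicCompletion K))) w)) ^ k :=
    fun a k h h' ↦ h ((map_mem_maximalIdeal_pow_iff hw hφ a k).mp h')
  have hΔφ : ∀ D : WeierstrassCurve.VariableChange (v.adicCompletionIntegers K), ((D • X₀).map φ).Δ ≠ 0 := fun D h0 ↦ by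
    rw [WeierstrassCurve.map_Δ, WeierstrassCurve.variableChange_Δ, map_mul,
      mul_eq_zero] at h0
    rcases h0 with h0 | h0
    · exact (((D.u⁻¹ ^ 12).isUnit.map φ).ne_zero) (by simpa using h0)
    · exact hΔ (injective_of_coe_eq_algebraMap hφ (by rw [h0, map_zero]))
  have hidx : ∀ D : WeierstrassCurve.VariableChange (v.adicCompletionIntegers K),
      (((D • X₀).map φ).nonsingularReductionSubgroup hvR).index =
      ((X₀.map φ).nonsingularReductionSubgroup hvR).index := fun D ↦ by
    rw [← WeierstrassCurve.map_variableChange]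
    exact index_nonsingularReductionSubgroup_smul (X₀.map φ) (D.map φ)
  have hall : ∀ J : WeierstrassCurve (Valuation.valuationSubring (Valuation.comap (algebraMap (maxUnramified (v.adicCompletion K)) (AlgebraicClosure (v.adicCompletion K))) w)),
      (∀ a b : (Valuation.valuationSubring (Valuation.comap (algebraMap (maxUnramified (v.adicCompletion K)) (AlgebraicClosure (v.adicCompletion K))) w)), J.toAffine.Equation a b →
        ¬ (J.map (residue (Valuation.valuationSubring (Valuation.comap (algebraMap (maxUnramified (v.adicCompletion K)) (AlgebraicClosure (v.adicCompletion K))) w)))).toAffine.Nonsingular (residue (Valuation.valuationSubring (Valuation.comap (algebraMap (maxUnramified (v.adicCompletion K)) (AlgebraicClosure (v.adicCompletion K))) w)) a) (residue (Valuation.valuationSubring (Valuation.comap (algebraMap (maxUnramified (v.adicCompletion K)) (AlgebraicClosure (v.adicCompletion K))) w)) b) → False) →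
      (J.nonsingularReductionSubgroup hvR).index = 1 := by
    intro J hJ
    rw [AddSubgroup.index_eq_one, eq_top_iff]
    intro P _
    rw [WeierstrassCurve.mem_nonsingularReductionSubgroup_iff]
    rcases point_cases hvR P with rfl | ⟨x, y, h, rfl, hx⟩ | ⟨a, b, h, rfl⟩
    · trivial
    · exact Or.inl ((not_mem_range_iff hvR).mpr hx)
    · refine (WeierstrassCurve.hasNonsingularReduction_some_algebraMap_iff hinjR h).mpr ?_
      have he : J.toAffine.Equation a b :=
        (WeierstrassCurve.Affine.map_equation _ hinjR a b).mp h.left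
      by_contra hns
      exact hJ a b he hns
  generalize hs' : X₀.kodairaSymbolOfMinimal = s at hs hps
  cases s with
  | I n =>
    exfalso
    rcases Nat.eq_zero_or_pos n with rfl | hn
    · exact hs.1 rfl
    · exact hs.2 ⟨n, hn.ne', rfl⟩
  | II =>
    obtain ⟨hΔm, -, ha₆⟩ := kodairaSymbolOfMinimal_eq_II_imp X₀ hs'
    have hex := exists_variableChange_step2_of_perfectField X₀ hΔm
    rw [show normalizeStep2 X₀ = hex.choose • X₀ from dif_pos hex] at ha₆
    obtain ⟨-, h3, h4, h6⟩ := hex.choose_spec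
    have key := hall ((hex.choose • X₀).map φ) fun a b he hns ↦ by
      obtain ⟨ha, hb⟩ := mem_maximalIdeal_of_not_nonsingular (T1 _ h3) (T1 _ h4) (T1 _ h6) he hns
      exact N _ 2 ha₆ (a₆_mem_sq_of_equation (T1 _ h3) (T1 _ h4) he ha hb)
    rw [hidx] at key
    rw [key]; exact hp2
  | III =>
    obtain ⟨D, h1, h2, h3, h4, h4', h6⟩ := exists_smul_of_kodairaSymbolOfMinimal_eq_III X₀ hs'
    have key := index_eq_two_of_normalForm_III (K := (maxUnramified (v.adicCompletion K))) ((D • X₀).map φ) (hΔφ D) (T1 _ h1)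
      (T1 _ h2) (T1 _ h3) (T1 _ h4) (N _ 2 h4') (T _ 2 h6)
    rw [hidx] at key
    simp only [KodairaSymbol.componentGroupOrder] at hps
    rw [key]; exact hps
  | IV =>
    obtain ⟨D, h1, h2, h3, h4, h6, hb₆⟩ := exists_smul_of_kodairaSymbolOfMinimal_eq_IV X₀ hs'
    have hb₆' : ((D • X₀).map φ).b₆ ∉ maximalIdeal (Valuation.valuationSubring (Valuation.comap (algebraMap (maxUnramified (v.adicCompletion K)) (AlgebraicClosure (v.adicCompletion K))) w)) ^ 3 := by
      rw [WeierstrassCurve.map_b₆]; exact N _ 3 hb₆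
    have key := index_mem_of_normalForm_IV (K := (maxUnramified (v.adicCompletion K))) ((D • X₀).map φ) (T1 _ h1) (T1 _ h2)
      (T1 _ h3) (T _ 2 h4) (T _ 2 h6) hb₆'
    rw [hidx] at key
    simp only [KodairaSymbol.componentGroupOrder] at hps
    rcases key with key | key <;> rw [key]
    · exact hp2
    · exact hps
  | Istar n =>
    cases n with
    | zero =>
      obtain ⟨D, h1, h2, h3, h4, h6, hP3⟩ :=
        exists_smul_of_kodairaSymbolOfMinimal_eq_Istar_zero X₀ hΔ hs'
      have hP3' := distinctRootCount_cubicStep6_map_eq_three hw hφ (D • X₀) h2 h4 h6 hP3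
      have key := index_mem_of_normalForm_Istar_zero (K := (maxUnramified (v.adicCompletion K))) ((D • X₀).map φ) (T1 _ h1)
        (T1 _ h2) (T _ 2 h3) (T _ 2 h4) (T _ 3 h6) hP3'
      rw [hidx] at key
      simp only [KodairaSymbol.componentGroupOrder] at hps
      have hp2' : ¬ p ∣ 2 := fun h ↦ hps (h.trans ⟨2, rfl⟩)
      rcases key with key | key | key <;> rw [key]
      · exact hp2
      · exact hp2'
      · exact hps
    | succ n =>
      obtain ⟨D, h1, h2, h2', h3, h4, h6⟩ :=
        exists_smul_of_kodairaSymbolOfMinimal_eq_Istar_succ X₀ hs'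
      have key := index_mem_of_normalForm_Istar_succ (K := (maxUnramified (v.adicCompletion K))) ((D • X₀).map φ) (hΔφ D)
        (T1 _ h1) (T1 _ h2) (N _ 2 h2') (T _ 2 h3) (T _ 3 h4) (T _ 4 h6)
      rw [hidx] at key
      simp only [KodairaSymbol.componentGroupOrder] at hps
      have hp2' : ¬ p ∣ 2 := fun h ↦ hps (h.trans ⟨2, rfl⟩)
      rcases key with key | key <;> rw [key]
      · exact hp2'
      · exact hps
  | IVstar =>
    obtain ⟨D, h1, h2, h3, h4, h6, h8⟩ := exists_smul_of_kodairaSymbolOfMinimal_eq_IVstar X₀ hs'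
    have h8' := distinctRootCount_quadraticStep8_map_eq_two hw hφ (D • X₀) h3 h6 h8
    have key := index_mem_of_normalForm_IVstar (K := (maxUnramified (v.adicCompletion K))) ((D • X₀).map φ) (T1 _ h1) (T _ 2 h2)
      (T _ 2 h3) (T _ 3 h4) (T _ 4 h6) h8'
    rw [hidx] at key
    simp only [KodairaSymbol.componentGroupOrder] at hps
    rcases key with key | key <;> rw [key]
    · exact hp2
    · exact hps
  | IIIstar =>
    obtain ⟨D, h1, h2, h3, h4, h4', h6⟩ :=
      exists_smul_of_kodairaSymbolOfMinimal_eq_IIIstar X₀ hs'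
    have key := index_eq_two_of_normalForm_IIIstar (K := (maxUnramified (v.adicCompletion K))) ((D • X₀).map φ) (hΔφ D) (T1 _ h1)
      (T _ 2 h2) (T _ 3 h3) (T _ 3 h4) (N _ 4 h4') (T _ 5 h6)
    rw [hidx] at key
    simp only [KodairaSymbol.componentGroupOrder] at hps
    rw [key]; exact hps
  | IIstar =>
    obtain ⟨D, h1, h2, h3, h4, h6, h6'⟩ := exists_smul_of_kodairaSymbolOfMinimal_eq_IIstar X₀ hs'
    have key := hall ((D • X₀).map φ) fun a b he hns ↦ by
      obtain ⟨ha, hb⟩ := mem_maximalIdeal_of_not_nonsingular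
        (Ideal.pow_le_self three_ne_zero (T _ 3 h3))
        (Ideal.pow_le_self four_ne_zero (T _ 4 h4)) (Ideal.pow_le_self (by norm_num) (T _ 5 h6))
        he hns
      apply N _ 6 h6'
      have hd := dvd_a₆_of_equation_IIstar (irreducible_uniformizer (R := (Valuation.valuationSubring (Valuation.comap (algebraMap (maxUnramified (v.adicCompletion K)) (AlgebraicClosure (v.adicCompletion K))) w))))
        (mem_maximalIdeal_iff_dvd.mp (T1 _ h1)) (mem_maximalIdeal_pow_iff_dvd.mp (T _ 2 h2))
        (mem_maximalIdeal_pow_iff_dvd.mp (T _ 3 h3)) (mem_maximalIdeal_pow_iff_dvd.mp (T _ 4 h4))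
        (mem_maximalIdeal_pow_iff_dvd.mp (T _ 5 h6)) he (mem_maximalIdeal_iff_dvd.mp ha)
        (mem_maximalIdeal_iff_dvd.mp hb)
      exact mem_maximalIdeal_pow_iff_dvd.mpr hd
    rw [hidx] at key
    rw [key]; exact hp2


end IsDedekindDomain.HeightOneSpectrum

/-! ## The `K̄_v`-form: an exponent `c ≤ 4`, `p ∤ c`, on the `I_𝔐`-fixed points when `p ∤ #Φ(k̄)` -/

namespace WeierstrassCurve

open Literature.NumberTheory.EllipticCurves Literature.NumberTheory.EllipticCurves.LocalIndex
  Literature.NumberTheory.GaloisRepresentations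
  Literature.NumberTheory.GaloisRepresentations.IsNonarchimedeanLocalField
  Literature.NumberTheory.DiophantineGeometry Literature.NumberTheory.DiophantineGeometry.TateAlgorithm
  Literature.NumberTheory.DiophantineGeometry.KodairaSymbol
  IsDedekindDomain IsDedekindDomain.HeightOneSpectrum

variable {K : Type u} [Field K] [NumberField K] {v : HeightOneSpectrum (𝓞 K)}
  (X : WeierstrassCurve (v.adicCompletion K))

set_option maxHeartbeats 4000000 in
/-- **Kodaira–Néron at an additive place with `p ∤ #Φ(k̄)` as an exponent `c ≤ 4` with `p ∤ c`**
(Silverman, *AEC* Thm. VII.6.1 over `K^nr`; *ATAEC* Cor. IV.9.2(d), Table 4.1).  For an elliptic curve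
over `K_v` given by a minimal Weierstrass equation `X` with ADDITIVE reduction, a prime `p` not dividing
`componentGroupOrder` of the Tate type of the integral model `X₀ = X.integralModel 𝓞_v` (`#Φ(k̄)` of
Table 4.1), `w = |·|_v` the spectral valuation of `K̄_v` and `𝔐` the prime of `ar 𝓞_v` above `𝓂_v`:
there is `c` with `0 < c ≤ 4`, `p ∤ c` — the index `[E(K_v^nr) : E₀(K_v^nr)]` — such that `c • P ∈ E₀`
for every point `P ∈ X(K̄_v)` fixed by the inertia group `I_𝔐`.  Proof:
`exists_nsmul_reducesToNonsingular_not_three_dvd_of_hasAdditiveReduction` verbatim with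
`not_dvd_index_nonsingularReductionSubgroup_map_of_isAdditive` carried through.
[cite: SilvermanAEC2009, Thm. VII.6.1 with Cor. VII.6.2 (PDF p. 177)]
[cite: SilvermanATAEC1994, Cor. IV.9.2(d) with Table 4.1 (PDF pp. 340, 365)] -/
theorem exists_nsmul_reducesToNonsingular_not_dvd_of_hasAdditiveReduction [hXell : X.IsElliptic]
    [hadd : X.HasAdditiveReduction (v.adicCompletionIntegers K)] {p : ℕ} (hp : p.Prime)
    (hps : ¬ p ∣ (X.integralModel (v.adicCompletionIntegers K)).kodairaSymbolOfMinimal.componentGroupOrder)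
    (w : Valuation (AlgebraicClosure (v.adicCompletion K)) ℝ≥0)
    (hw : ∀ x, (w x : ℝ) =
      spectralNorm (v.adicCompletion K) (AlgebraicClosure (v.adicCompletion K)) x)
    {𝔐 : Ideal (localAbsIntegers v)} (h𝔐 : 𝔐 ∈ v.localPrimesAbove) :
    ∃ c : ℕ, 0 < c ∧ c ≤ 4 ∧ ¬ p ∣ c ∧
      ∀ P : (X.baseChange (AlgebraicClosure (v.adicCompletion K))).toAffine.Point,
        (∀ σ ∈ 𝔐.inertia (absoluteGaloisGroup (v.adicCompletion K)),
          Affine.Point.map ((absoluteGaloisGroup.toAlgEquiv _ σ :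
              AlgebraicClosure (v.adicCompletion K) ≃ₐ[v.adicCompletion K]
                AlgebraicClosure (v.adicCompletion K)) :
              AlgebraicClosure (v.adicCompletion K) →ₐ[v.adicCompletion K]
                AlgebraicClosure (v.adicCompletion K)) P = P) →
        ReducesToNonsingular w (IsLocalRing.residue w.integer) (c • P) := by
  haveI hXmin : X.IsMinimal (v.adicCompletionIntegers K) := hadd.toIsMinimal
  -- the classical decidable equality on `K_v^nr`, as in the index theorems of the tree
  letI instDec : DecidableEq (maxUnramified (v.adicCompletion K)) := fun a b => Classical.propDecidable (a = b)
  haveI := isDiscreteValuationRing_unrIntegers hw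
  haveI := henselianLocalRing_unrIntegers hw
  haveI : PerfectField (ResidueField (v.adicCompletionIntegers K)) := PerfectField.ofFinite
  obtain ⟨φ, hφ⟩ := exists_ringHom_adicCompletionIntegers_unrIntegers hw
  obtain ⟨ψ, hψ⟩ := exists_ringHom_unrIntegers_integer (w := w)
  have hvR := integers_valuationRing_valuation (Valuation.valuationSubring (Valuation.comap (algebraMap (maxUnramified (v.adicCompletion K)) (AlgebraicClosure (v.adicCompletion K))) w)) (maxUnramified (v.adicCompletion K))
  have hinjR := IsFractionRing.injective (Valuation.valuationSubring (Valuation.comap (algebraMap (maxUnramified (v.adicCompletion K)) (AlgebraicClosure (v.adicCompletion K))) w)) (maxUnramified (v.adicCompletion K))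
  have hX₀K : (X.integralModel (v.adicCompletionIntegers K)).baseChange (v.adicCompletion K) = X :=
    WeierstrassCurve.baseChange_integralModel_eq (v.adicCompletionIntegers K) X
  have hΔ : (X.integralModel (v.adicCompletionIntegers K)).Δ ≠ 0 := fun h0 ↦ by
    have : X.Δ = 0 := by
      rw [← hX₀K]
      change ((X.integralModel (v.adicCompletionIntegers K)).map (algebraMap _ _)).Δ = 0
      rw [WeierstrassCurve.map_Δ, h0, map_zero]
    exact hXell.isUnit.ne_zero this
  /- (1) the index of `E₀` in `J(K_v^nr)`, `J = X₀ ⊗ 𝒪ⁿʳ`, is `≠ 0` and `≤ 4` (additive type) -/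
  have hΔm : (X.integralModel (v.adicCompletionIntegers K)).Δ ∈ maximalIdeal (v.adicCompletionIntegers K) := by
    have h := hadd.badReduction
    rw [← WeierstrassCurve.integralModel_Δ_eq (v.adicCompletionIntegers K) X] at h
    exact (valuation_lt_one_iff_mem _ _).mp h
  have hc₄m : (X.integralModel (v.adicCompletionIntegers K)).c₄ ∈ maximalIdeal (v.adicCompletionIntegers K) := by
    have h := hadd.additiveReduction
    rw [← WeierstrassCurve.integralModel_c₄_eq (v.adicCompletionIntegers K) X] at h
    exact (valuation_lt_one_iff_mem _ _).mp h
  have hmin : ((X.integralModel (v.adicCompletionIntegers K)).baseChange (v.adicCompletion K)).IsMinimal (v.adicCompletionIntegers K) := by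
    rw [hX₀K]; exact hXmin
  have hsym : (X.integralModel (v.adicCompletionIntegers K)).kodairaSymbolOfMinimal.IsAdditive :=
    (isAdditive_kodairaSymbolOfMinimal_iff (v.adicCompletion K) hΔ hmin).mpr ⟨hΔm, hc₄m⟩
  have hfin : (((X.integralModel (v.adicCompletionIntegers K)).map φ).nonsingularReductionSubgroup hvR).index ≠ 0 :=
    index_nonsingularReductionSubgroup_map_ne_zero_of_isAdditive hw hφ _ hΔ hsym
  have hle4 : (((X.integralModel (v.adicCompletionIntegers K)).map φ).nonsingularReductionSubgroup hvR).index ≤ 4 :=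
    index_nonsingularReductionSubgroup_map_le_four_of_isAdditive hw hφ _ hΔ hsym
  have h3 : ¬ p ∣ (((X.integralModel (v.adicCompletionIntegers K)).map φ).nonsingularReductionSubgroup hvR).index :=
    not_dvd_index_nonsingularReductionSubgroup_map_of_isAdditive hw hφ _ hΔ hsym hp hps
  /- the model `J = X₀ ⊗ 𝒪ⁿʳ`, its base changes to `K_v^nr` and to `𝒪_w`, `K̄_v` -/
  have hJ : ((X.integralModel (v.adicCompletionIntegers K)).map φ).baseChange (maxUnramified (v.adicCompletion K)) = X.baseChange (maxUnramified (v.adicCompletion K)) := by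
    conv_rhs => rw [← hX₀K]
    change ((X.integralModel (v.adicCompletionIntegers K)).map φ).map (algebraMap _ _) =
      ((X.integralModel (v.adicCompletionIntegers K)).map (algebraMap (v.adicCompletionIntegers K) (v.adicCompletion K))).map (algebraMap (v.adicCompletion K) (maxUnramified (v.adicCompletion K)))
    rw [WeierstrassCurve.map_map, WeierstrassCurve.map_map]
    congr 1
    refine RingHom.ext fun a ↦ Subtype.ext ?_
    change (((φ a : (Valuation.valuationSubring (Valuation.comap (algebraMap (maxUnramified (v.adicCompletion K)) (AlgebraicClosure (v.adicCompletion K))) w))) : (maxUnramified (v.adicCompletion K))) : (AlgebraicClosure (v.adicCompletion K))) = ((algebraMap (v.adicCompletion K) (maxUnramified (v.adicCompletion K)) (algebraMap (v.adicCompletionIntegers K) (v.adicCompletion K) a) : (maxUnramified (v.adicCompletion K))) : (AlgebraicClosure (v.adicCompletion K)))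
    rw [hφ, IntermediateField.coe_algebraMap_apply]
    rfl
  have hW₀ : (((X.integralModel (v.adicCompletionIntegers K)).map φ).map ψ).baseChange (AlgebraicClosure (v.adicCompletion K)) = X.baseChange (AlgebraicClosure (v.adicCompletion K)) := by
    conv_rhs => rw [← hX₀K]
    change (((X.integralModel (v.adicCompletionIntegers K)).map φ).map ψ).map (algebraMap _ _) =
      ((X.integralModel (v.adicCompletionIntegers K)).map (algebraMap (v.adicCompletionIntegers K) (v.adicCompletion K))).map (algebraMap (v.adicCompletion K) (AlgebraicClosure (v.adicCompletion K)))
    rw [WeierstrassCurve.map_map, WeierstrassCurve.map_map, WeierstrassCurve.map_map]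
    congr 1
    refine RingHom.ext fun a ↦ ?_
    change ((ψ (φ a) : w.integer) : (AlgebraicClosure (v.adicCompletion K))) = algebraMap (v.adicCompletion K) (AlgebraicClosure (v.adicCompletion K)) (algebraMap (v.adicCompletionIntegers K) (v.adicCompletion K) a)
    rw [hψ, hφ]
    rfl
  -- the residue field of `𝒪ⁿʳ` embeds into that of `𝒪_w`
  haveI hψloc : IsLocalHom ψ := ⟨fun a ha ↦ by
    by_contra hna
    have hmem : a ∈ maximalIdeal (Valuation.valuationSubring (Valuation.comap (algebraMap (maxUnramified (v.adicCompletion K)) (AlgebraicClosure (v.adicCompletion K))) w)) :=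
      (IsLocalRing.mem_maximalIdeal _).mpr (mem_nonunits_iff.mpr hna)
    have := (map_mem_maximalIdeal_integer_iff hψ a).mpr hmem
    exact (mem_nonunits_iff.mp ((IsLocalRing.mem_maximalIdeal _).mp this)) ha⟩
  have hκ : (((X.integralModel (v.adicCompletionIntegers K)).map φ).map ψ).map (residue w.integer) =
      ((((X.integralModel (v.adicCompletionIntegers K)).map φ).map (residue (Valuation.valuationSubring (Valuation.comap (algebraMap (maxUnramified (v.adicCompletion K)) (AlgebraicClosure (v.adicCompletion K))) w)))).map
        (IsLocalRing.ResidueField.map ψ)) := by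
    simp only [WeierstrassCurve.map_map]
    congr 1
  /- the maps on points: `J(K_v^nr) ≃ X(K_v^nr) → X(K̄_v)` -/
  set e₁ := WeierstrassCurve.Affine.Point.congrEquiv hJ with he₁
  set ι : (X.baseChange (maxUnramified (v.adicCompletion K))).toAffine.Point →+ (X.baseChange (AlgebraicClosure (v.adicCompletion K))).toAffine.Point :=
    WeierstrassCurve.Affine.Point.map (W' := X)
      (IsScalarTower.toAlgHom (v.adicCompletion K) (maxUnramified (v.adicCompletion K)) (AlgebraicClosure (v.adicCompletion K))) with hι
  -- (3) `I_𝔐`-fixed points of `X(K̄_v)` come from `X(K_v^nr)`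
  have hsurj : ∀ P : (X.baseChange (AlgebraicClosure (v.adicCompletion K))).toAffine.Point,
      (∀ σ ∈ 𝔐.inertia (absoluteGaloisGroup (v.adicCompletion K)),
        WeierstrassCurve.Affine.Point.map
          ((absoluteGaloisGroup.toAlgEquiv _ σ : (AlgebraicClosure (v.adicCompletion K)) ≃ₐ[(v.adicCompletion K)] (AlgebraicClosure (v.adicCompletion K))) : (AlgebraicClosure (v.adicCompletion K)) →ₐ[(v.adicCompletion K)] (AlgebraicClosure (v.adicCompletion K))) P = P) →
        ∃ Q, ι Q = P := by
    intro P hP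
    rcases P with _ | ⟨x, y, h⟩
    · exact ⟨0, map_zero ι⟩
    · have hx : x ∈ (maxUnramified (v.adicCompletion K)) := (mem_maxUnramified_iff_forall_inertia hw h𝔐).mpr fun σ hσ ↦ by
        have := hP σ hσ
        rw [WeierstrassCurve.Affine.Point.map_some, WeierstrassCurve.Affine.Point.some.injEq] at this
        exact this.1
      have hy : y ∈ (maxUnramified (v.adicCompletion K)) := (mem_maxUnramified_iff_forall_inertia hw h𝔐).mpr fun σ hσ ↦ by
        have := hP σ hσ
        rw [WeierstrassCurve.Affine.Point.map_some, WeierstrassCurve.Affine.Point.some.injEq] at this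
        exact this.2
      have hinjι : Function.Injective (IsScalarTower.toAlgHom (v.adicCompletion K) (maxUnramified (v.adicCompletion K)) (AlgebraicClosure (v.adicCompletion K))) :=
        fun a b hab ↦ Subtype.ext hab
      have h₀ : (X.baseChange (maxUnramified (v.adicCompletion K))).toAffine.Nonsingular ⟨x, hx⟩ ⟨y, hy⟩ :=
        (WeierstrassCurve.Affine.baseChange_nonsingular (W := X)
          (f := IsScalarTower.toAlgHom (v.adicCompletion K) (maxUnramified (v.adicCompletion K)) (AlgebraicClosure (v.adicCompletion K))) hinjι ⟨x, hx⟩ ⟨y, hy⟩).mp h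
      exact ⟨.some _ _ h₀, rfl⟩
  -- (4) `E₀` of `J` over `𝒪ⁿʳ` maps into `E₀` of `X` over `𝒪_w`
  have hE₀ : ∀ Q : (((X.integralModel (v.adicCompletionIntegers K)).map φ).baseChange (maxUnramified (v.adicCompletion K))).toAffine.Point,
      ((X.integralModel (v.adicCompletionIntegers K)).map φ).HasNonsingularReduction Q →
        ReducesToNonsingular w (residue w.integer) (ι (e₁ Q)) := by
    intro Q hQ
    rcases point_cases hvR Q with rfl | ⟨x, y, h, rfl, hx⟩ | ⟨a, b, h, rfl⟩
    · rw [map_zero, map_zero]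
      exact reducesToNonsingular_zero
    · have hx' : 1 < w (x : (AlgebraicClosure (v.adicCompletion K))) := not_le.mp fun hle ↦
        (not_mem_range_iff hvR).mpr hx ⟨⟨x, (Valuation.mem_valuationSubring_iff _ _).mpr hle⟩, rfl⟩
      rw [he₁, WeierstrassCurve.Affine.Point.congrEquiv_some]
      exact reducesToNonsingular_of_one_lt hx'
    · have hns := (WeierstrassCurve.hasNonsingularReduction_some_algebraMap_iff hinjR h).mp hQ
      rw [he₁, WeierstrassCurve.Affine.Point.congrEquiv_some]
      -- transport to the `𝒪_w`-model `J ⊗ 𝒪_w` of `X ⊗ K̄ᵥ`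
      rw [← (WeierstrassCurve.Affine.Point.congrEquiv hW₀).apply_symm_apply (ι _),
        reducesToNonsingular_congrEquiv_iff, reducesToNonsingular_iff_hasNonsingularReduction]
      change (((X.integralModel (v.adicCompletionIntegers K)).map φ).map ψ).HasNonsingularReduction
        ((WeierstrassCurve.Affine.Point.congrEquiv hW₀).symm
          (WeierstrassCurve.Affine.Point.some _ _ _))
      rw [WeierstrassCurve.Affine.Point.congrEquiv_symm_some]
      refine Or.inr ⟨ψ a, ψ b, hψ a, hψ b, ?_⟩
      rw [hκ, ← IsLocalRing.ResidueField.map_residue, ← IsLocalRing.ResidueField.map_residue]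
      exact (WeierstrassCurve.Affine.map_nonsingular _
        (IsLocalRing.ResidueField.map ψ).injective _ _).mpr hns
  /- the exponent `c = [J(K_v^nr) : E₀]` -/
  set H := ((X.integralModel (v.adicCompletionIntegers K)).map φ).nonsingularReductionSubgroup hvR with hH
  refine ⟨H.index, Nat.pos_of_ne_zero hfin, hle4, h3, fun P hP ↦ ?_⟩
  obtain ⟨P₀, rfl⟩ := hsurj P hP
  set Q₀ := e₁.symm P₀ with hQ₀
  have hP₀ : ι P₀ = ι (e₁ Q₀) := by rw [hQ₀, AddEquiv.apply_symm_apply]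
  rw [hP₀, ← map_nsmul, ← map_nsmul]
  apply hE₀
  exact (AddSubgroup.nsmul_index_mem H Q₀ : _)

end WeierstrassCurve

end
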